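import Literature.Probability.LatticeModels.FieldCurrentsTheta
import Literature.Probability.LatticeModels.MeanFieldDifferentialInequality
import HarnessLib

/-!
# The tree bound for a double current with two pairs of sources (Aizenman–Fernández 1986, Lemma 5.4), for general couplings

Topic `Probability/LatticeModels`, namespace `Literature.Probability.LatticeModels`. Sequel of
`MeanFieldDifferentialInequality` (pair sums `currentPairSum` on the ghost graph, factorisation on
`{𝒮_b = S}`) and `FieldCurrentsTheta` (the Gibbs state `⟨·⟩_θ` with edge-dependent couplings
`θ ≥ 0`, its random-current representation, Griffiths II in `θ`, the systems `cplOff θ D` with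
bonds switched off).

**Lemma 5.4** of Aizenman–Fernández 1986 (stated there at `h = 0`; the proof printed on
pp. 428–429 works verbatim for every system of nonnegative pair couplings, in particular for the
`θ`-system on `Λ ∪ {g}`): for `x, y, u, l ∈ Λ`,

  `Z⁻² ∑_{∂n₁ = {x}Δ{u}, ∂n₂ = {u}Δ{y}} w w 𝟙[x ↔ l] ≤ ⟨σ_xσ_l⟩⟨σ_lσ_u⟩⟨σ_uσ_y⟩ + (x ⇔ y)`.   (5.13)

Proof as printed: write `𝟙[x ↔ l] = 1 - 𝟙[x ↮ l]` and condition the second term on the cluster of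
`l` (Lemma 5.1, (5.1)): `= ⟨σ_xσ_u⟩⟨σ_uσ_y⟩ - E{⟨σ_xσ_u⟩_{C^c(l)}⟨σ_uσ_y⟩_{C^c(l)}}`; add and
subtract `⟨σ_uσ_y⟩E{⟨σ_xσ_u⟩_{C^c(l)}}` ((5.14)), bound the last term by Griffiths II
(`⟨σ_xσ_u⟩_{C^c(l)} ≤ ⟨σ_xσ_u⟩`, `⟨σ_uσ_y⟩_{C^c(l)} ≤ ⟨σ_uσ_y⟩`), and use (5.1) and the switching
lemma: `⟨σ_xσ_u⟩ - E{⟨σ_xσ_u⟩_{C^c(l)}} = Z⁻²∑_{{x,u},∅} w w 𝟙[x ↔ l] = ⟨σ_lσ_u⟩⟨σ_xσ_l⟩`.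

## Contents

* `currentPairSum_cplOff` — the pair sums of `θ 𝟙_{Dᶜ}` are the pair sums of `θ` restricted to
  currents supported off `D` (used to apply the lemma inside a sub-volume).
* `currentPairSum_eq_sum_clusterCompl'` — decomposition over the values of `𝒮_b`, any `b`.
* `dctWb` — the law `W_b(T) = ∑_{∅,∅} w w 𝟙[𝒮_b = T]` (`dctW` is the case `b = g`).
* `toReal_currentPairSum_pairs_clusterCompl_eq` — **(5.1) for two pairs**: for `T ∌ b` containing
  the four (lifted) sources, `∑_{(ab)*,(ce)*} w w 𝟙[𝒮_b = T] = ⟨σ_aσ_b⟩_{θ_T} ⟨σ_cσ_e⟩_{θ_T} W_b(T)`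
  with `θ_T = θ` off the edges inside `T` switched off (`cplOff`).
* `af_treeBound` — **Lemma 5.4** for general `θ ≥ 0`.

## References

* M. Aizenman, R. Fernández, J. Stat. Phys. **44** (1986) 393–454, §5.1: Lemma 5.1 (5.1)–(5.2),
  Lemma 5.4 (5.13)–(5.14), pp. 425, 428–429 [AizenmanFernandezJSP1986] (held: author copy
  `paper:url-b8cebc3f44bb`, PDF pp. 33, 36–37).
* H. Duminil-Copin, V. Tassion, CMP **343** (2016) 725, proof of Lemma 2.6, Claims 1–2
  (arXiv:1502.03050 numbering) [DuminilCopinTassionCMP2016].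
-/

noncomputable section

open Finset MeasureTheory
open scoped symmDiff ENNReal

namespace Literature.Probability.LatticeModels

variable {V : Type*} [DecidableEq V]

section TreeBound

variable {G : SimpleGraph V} [G.LocallyFinite] {Λ : Finset V}

local notation "Gg" => ghostGraph G Λ
local notation "Λg" => Finset.insertNone Λ
local notation "Eg" => edgesIn (ghostGraph G Λ) (Finset.insertNone Λ)
local notation "Zg[" θ ", " X "]" =>
  gcurrentZ (ghostGraph G Λ) (Finset.insertNone Λ) θ (edgesIn (ghostGraph G Λ) (Finset.insertNone Λ)) X
local notation "Conn[" m ", " u ", " v "]" =>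
  CConn (ghostGraph G Λ) (Finset.insertNone Λ) m (edgesIn (ghostGraph G Λ) (Finset.insertNone Λ)) u v
local notation "∂g" => csources (ghostGraph G Λ) (Finset.insertNone Λ)
local notation "𝒮[" m ", " b "]" => clusterCompl (ghostGraph G Λ) (Finset.insertNone Λ) m b

/-! ### Pair sums with bonds switched off -/

/-- The weight of `θ 𝟙_{Dᶜ}`: a current charging an edge of `D` has weight `0`, any other
current keeps its weight. [folklore] -/
theorem gweight_cplOff (θ : Sym2 (Option V) → ℝ) (D : Finset (Sym2 (Option V))) (n : Eg → ℕ) :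
    gweight Gg Λg (cplOff θ D) n = ind (CSupp Gg Λg (Eg \ D) n) * gweight Gg Λg θ n := by
  by_cases hs : CSupp Gg Λg (Eg \ D) n
  · rw [ind_of_true hs, one_mul]
    exact gweight_congr fun e he => cplOff_of_not_mem (mem_sdiff.1 (hs e he)).2
  · rw [ind_of_false hs, zero_mul]
    have hall : ¬∀ e : Eg, n e ≠ 0 → (e : Sym2 (Option V)) ∉ D := fun hcon =>
      hs fun e he => mem_sdiff.2 ⟨e.2, hcon e he⟩
    obtain ⟨e, he⟩ := not_forall.1 hall
    obtain ⟨hne, heD⟩ := Classical.not_imp.1 he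
    exact gweight_eq_zero_of_apply_ne_zero (cplOff_of_mem (not_not.1 heD)) hne

/-- **Pair sums of the system with the bonds of `D` switched off** are the pair sums of `θ` over
currents supported off `D`:
`∑^{θ𝟙_{Dᶜ}}_{X,Y} w w F = ∑^{θ}_{X,Y} w w 𝟙[n₁ + n₂ ≡ 0 on D] F`. [cite: AizenmanFernandezJSP1986, §3.3, conventions after eq. (3.10)] -/
theorem currentPairSum_cplOff (θ : Sym2 (Option V) → ℝ) (D : Finset (Sym2 (Option V))) (X Y : Finset (Option V))
    (F : (Eg → ℕ) → ℝ≥0∞) :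
    currentPairSum G Λ (cplOff θ D) X Y F =
      currentPairSum G Λ θ X Y (fun m => ind (CSupp Gg Λg (Eg \ D) m) * F m) := by
  unfold currentPairSum
  refine tsum_congr fun p => ?_
  have hadd : ind (CSupp Gg Λg (Eg \ D) (p.1 + p.2)) =
      ind (CSupp Gg Λg (Eg \ D) p.1) * ind (CSupp Gg Λg (Eg \ D) p.2) := by
    rw [← ind_and]; exact ind_congr (csupp_add_iff p.1 p.2)
  dsimp only
  rw [gweight_cplOff, gweight_cplOff, hadd]
  ring

/-! ### Conditioning on the cluster of an arbitrary vertex -/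

/-- **Decomposition over the values of `𝒮_b`**: `∑ w w F = ∑_{T ⊆ Λ⁺} ∑ w w 𝟙[𝒮_b = T] F`. [cite: AizenmanFernandezJSP1986, §5.1, Lemma 5.1, eq. (5.1)] -/
theorem currentPairSum_eq_sum_clusterCompl' (θ : Sym2 (Option V) → ℝ) (b : Option V) (X Y : Finset (Option V))
    (F : (Eg → ℕ) → ℝ≥0∞) :
    currentPairSum G Λ θ X Y F =
      ∑ T ∈ (Λg).powerset, currentPairSum G Λ θ X Y (fun m => ind (𝒮[m, b] = T) * F m) := by
  rw [← currentPairSum_finset_sum]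
  refine currentPairSum_congr fun n₁ n₂ _ _ => ?_
  rw [← sum_mul, sum_ind_clusterCompl_eq, one_mul]

variable (G Λ) in
/-- **The law of `𝒮_b`**: `W_b(T) = ∑_{∂n₁ = ∂n₂ = ∅} w w 𝟙[𝒮_b = T]` (unnormalised; Aizenman–Fernández's
measure `E` of (5.2) restricted to the event `C^c(b) = T`; `dctW` is the case `b = g`). [cite: AizenmanFernandezJSP1986, §5.1, eqs. (5.1)–(5.2)] -/
def dctWb (θ : Sym2 (Option V) → ℝ) (b : Option V) (T : Finset (Option V)) : ℝ≥0∞ :=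
  currentPairSum G Λ θ ∅ ∅ (fun m => ind (𝒮[m, b] = T))

/-- `W_b(T)` is finite for `θ ≥ 0`. [folklore] -/
theorem dctWb_ne_top {θ : Sym2 (Option V) → ℝ} (hθ : ∀ e, 0 ≤ θ e) (b : Option V) (T : Finset (Option V)) :
    dctWb G Λ θ b T ≠ ∞ :=
  currentPairSum_ne_top hθ ∅ ∅ fun _ => ind_le_one _

/-- `∑_T W_b(T) = Z(∅)²`. [folklore] -/
theorem sum_dctWb_eq (θ : Sym2 (Option V) → ℝ) (b : Option V) :
    ∑ T ∈ (Λg).powerset, dctWb G Λ θ b T = Zg[θ, ∅] * Zg[θ, ∅] := by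
  rw [← currentPairSum_one]
  unfold dctWb
  rw [currentPairSum_eq_sum_clusterCompl' θ b ∅ ∅ (fun _ => 1)]
  exact sum_congr rfl fun T _ => currentPairSum_congr fun _ _ _ _ => by rw [mul_one]

/-- **(5.1) for two pairs of sources, in `ℝ≥0∞`**: for `T ⊆ Λ⁺`, `b ∈ Λ⁺ ∖ T` and sources
`X, Y ⊆ T`, `∑_{X,Y} w w 𝟙[𝒮_b = T] · Z_T(∅)² = Z_T(X) Z_T(Y) · W_b(T)` (both sides factorise through
the same outer sum). [cite: AizenmanFernandezJSP1986, §5.1, Lemma 5.1, eq. (5.1), p. 425] -/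
theorem currentPairSum_clusterCompl_mul_eq {θ : Sym2 (Option V) → ℝ} {T : Finset (Option V)} (hT : T ⊆ Λg)
    {b : Option V} (hb : b ∈ Λg \ T) {X Y : Finset (Option V)} (hX : X ⊆ T) (hY : Y ⊆ T) :
    currentPairSum G Λ θ X Y (fun m => ind (𝒮[m, b] = T)) *
        (gcurrentZ Gg Λg θ (edgesIn Gg T) ∅ * gcurrentZ Gg Λg θ (edgesIn Gg T) ∅) =
      gcurrentZ Gg Λg θ (edgesIn Gg T) X * gcurrentZ Gg Λg θ (edgesIn Gg T) Y * dctWb G Λ θ b T := by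
  unfold dctWb
  rw [currentPairSum_clusterCompl_eq θ hT hb, currentPairSum_clusterCompl_eq θ hT hb,
    filter_true_of_mem (fun v hv => hX hv), filter_false_of_mem (fun v hv => not_not.2 (hX hv)),
    filter_true_of_mem (fun v hv => hY hv), filter_false_of_mem (fun v hv => not_not.2 (hY hv))]
  simp only [filter_empty]
  ring

/-- The pair state of the system restricted to `T`: `⟨σ_aσ_c⟩_{θ_T} = Z_T(({a}Δ{c})*)/Z_T(∅)` with
`θ_T = θ 𝟙_{ℰ_T}` (Aizenman–Fernández's `⟨·⟩_{C^c(b)}`). [cite: AizenmanFernandezJSP1986, §3.3, Lemma 3.2, eq. (3.10)] -/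
theorem thetaCorr_cplOff_pair_eq {θ : Sym2 (Option V) → ℝ} (hθ : ∀ e, 0 ≤ θ e) {T : Finset (Option V)}
    (hT : T ⊆ Λg) {a c : V} (ha : a ∈ Λ) (hc : c ∈ Λ) :
    thetaCorr G Λ (cplOff θ (Eg \ edgesIn Gg T)) ({a} ∆ {c}) =
      (gcurrentZ Gg Λg θ (edgesIn Gg T) ({some a} ∆ {some c})).toReal /
        (gcurrentZ Gg Λg θ (edgesIn Gg T) ∅).toReal := by
  rw [thetaCorr_cplOff_eq_gcurrentZ_div hθ hT
    (symmDiff_le_sup.trans (sup_le (singleton_subset_iff.2 ha) (singleton_subset_iff.2 hc))), starSet_pair]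

/-- `Z_T(∅)` is positive and finite. [folklore] -/
theorem toReal_gcurrentZ_inner_empty_pos {θ : Sym2 (Option V) → ℝ} (hθ : ∀ e, 0 ≤ θ e) {T : Finset (Option V)}
    (hT : T ⊆ Λg) : 0 < (gcurrentZ Gg Λg θ (edgesIn Gg T) ∅).toReal :=
  ENNReal.toReal_pos (ne_of_gt (lt_of_lt_of_le zero_lt_one (one_le_gcurrentZ_empty (G := Gg) (Λ := Λg) θ _)))
    (gcurrentZ_ne_top hθ (edgesIn_mono Gg hT) ∅)

/-- **(5.1) for two pairs of sources, in real numbers**: for `T ⊆ Λ⁺`, `b ∈ Λ⁺ ∖ T`,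
`a, c, a', c' ∈ Λ` with lifts in `T`,
`∑_{({a}Δ{c})*, ({a'}Δ{c'})*} w w 𝟙[𝒮_b = T] = ⟨σ_aσ_c⟩_{θ_T} ⟨σ_{a'}σ_{c'}⟩_{θ_T} W_b(T)`. [cite: AizenmanFernandezJSP1986, §5.1, Lemma 5.1, eq. (5.1), p. 425] -/
theorem toReal_currentPairSum_pairs_clusterCompl_eq {θ : Sym2 (Option V) → ℝ} (hθ : ∀ e, 0 ≤ θ e)
    {T : Finset (Option V)} (hT : T ⊆ Λg) {b : Option V} (hb : b ∈ Λg \ T) {a c a' c' : V}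
    (ha : a ∈ Λ) (hc : c ∈ Λ) (ha' : a' ∈ Λ) (hc' : c' ∈ Λ)
    (haT : (some a : Option V) ∈ T) (hcT : (some c : Option V) ∈ T) (ha'T : (some a' : Option V) ∈ T)
    (hc'T : (some c' : Option V) ∈ T) :
    (currentPairSum G Λ θ ({some a} ∆ {some c}) ({some a'} ∆ {some c'}) (fun m => ind (𝒮[m, b] = T))).toReal =
      thetaCorr G Λ (cplOff θ (Eg \ edgesIn Gg T)) ({a} ∆ {c}) *
        thetaCorr G Λ (cplOff θ (Eg \ edgesIn Gg T)) ({a'} ∆ {c'}) * (dctWb G Λ θ b T).toReal := by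
  have hX : ({some a} ∆ {some c} : Finset (Option V)) ⊆ T :=
    symmDiff_le_sup.trans (sup_le (singleton_subset_iff.2 haT) (singleton_subset_iff.2 hcT))
  have hY : ({some a'} ∆ {some c'} : Finset (Option V)) ⊆ T :=
    symmDiff_le_sup.trans (sup_le (singleton_subset_iff.2 ha'T) (singleton_subset_iff.2 hc'T))
  have h1 := congrArg ENNReal.toReal (currentPairSum_clusterCompl_mul_eq (G := G) (Λ := Λ) (θ := θ) hT hb hX hY)
  rw [ENNReal.toReal_mul, ENNReal.toReal_mul, ENNReal.toReal_mul, ENNReal.toReal_mul] at h1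
  have hpos := toReal_gcurrentZ_inner_empty_pos (G := G) (Λ := Λ) hθ hT
  rw [thetaCorr_cplOff_pair_eq hθ hT ha hc, thetaCorr_cplOff_pair_eq hθ hT ha' hc']
  field_simp
  linear_combination h1

/-- **Griffiths II for the restricted system**: `⟨σ_aσ_c⟩_{θ_T} ≤ ⟨σ_aσ_c⟩_θ`. [cite: AizenmanFernandezJSP1986, §5.1, proof of Lemma 5.4 ("by using a Griffiths inequality"), p. 428] -/
theorem thetaCorr_cplOff_pair_le {θ : Sym2 (Option V) → ℝ} (hθ : ∀ e, 0 ≤ θ e) (T : Finset (Option V))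
    {a c : V} (ha : a ∈ Λ) (hc : c ∈ Λ) :
    thetaCorr G Λ (cplOff θ (Eg \ edgesIn Gg T)) ({a} ∆ {c}) ≤ thetaCorr G Λ θ ({a} ∆ {c}) :=
  thetaCorr_cplOff_le hθ _ (symmDiff_le_sup.trans (sup_le (singleton_subset_iff.2 ha) (singleton_subset_iff.2 hc)))

/-- `0 ≤ ⟨σ_aσ_c⟩_{θ_T}`. [folklore] -/
theorem thetaCorr_cplOff_pair_nonneg {θ : Sym2 (Option V) → ℝ} (hθ : ∀ e, 0 ≤ θ e) (T : Finset (Option V))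
    {a c : V} (ha : a ∈ Λ) (hc : c ∈ Λ) :
    0 ≤ thetaCorr G Λ (cplOff θ (Eg \ edgesIn Gg T)) ({a} ∆ {c}) :=
  thetaCorr_nonneg (cplOff_nonneg hθ _) (symmDiff_le_sup.trans (sup_le (singleton_subset_iff.2 ha) (singleton_subset_iff.2 hc)))

/-! ### The vanishing terms -/

/-- On `{𝒮_b = T}` with `some a ∈ T`, a current with sources `{a} Δ {c}` forces `some c ∈ T`:
otherwise the pair sum vanishes (first current). [folklore] -/
theorem currentPairSum_clusterCompl_eq_zero_left (θ : Sym2 (Option V) → ℝ) {T : Finset (Option V)} {b : Option V}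
    {a c : V} (haT : (some a : Option V) ∈ T) (hcT : (some c : Option V) ∉ T) (hc : c ∈ Λ)
    (Y : Finset (Option V)) (F : (Eg → ℕ) → ℝ≥0∞) :
    currentPairSum G Λ θ ({some a} ∆ {some c}) Y (fun m => ind (𝒮[m, b] = T) * F m) = 0 := by
  have h0 : currentPairSum G Λ θ ({some a} ∆ {some c}) Y (fun _ => 0) = 0 := by
    unfold currentPairSum; simp
  rw [← h0]
  refine currentPairSum_congr fun n₁ n₂ h1 _ => ?_
  by_cases hS : 𝒮[n₁ + n₂, b] = T
  · exfalso
    have hac : a ≠ c := fun h => hcT (h ▸ haT)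
    have hconn : Conn[n₁ + n₂, some a, some c] :=
      (cconn_of_csources_eq (fun h => hac (Option.some_injective _ h)) h1).mono fun e => Nat.le_add_right _ _
    have haS : (some a : Option V) ∈ 𝒮[n₁ + n₂, b] := hS ▸ haT
    have hcS : (some c : Option V) ∉ 𝒮[n₁ + n₂, b] := hS ▸ hcT
    rw [mem_clusterCompl] at haS hcS
    exact hcS ⟨Finset.some_mem_insertNone.2 hc, fun h => haS.2 (h.trans hconn.symm)⟩
  · rw [ind_of_false hS, zero_mul]

/-- The same for the second current. [folklore] -/
theorem currentPairSum_clusterCompl_eq_zero_right (θ : Sym2 (Option V) → ℝ) {T : Finset (Option V)} {b : Option V}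
    {a c : V} (haT : (some a : Option V) ∈ T) (hcT : (some c : Option V) ∉ T) (hc : c ∈ Λ)
    (X : Finset (Option V)) (F : (Eg → ℕ) → ℝ≥0∞) :
    currentPairSum G Λ θ X ({some a} ∆ {some c}) (fun m => ind (𝒮[m, b] = T) * F m) = 0 := by
  have h0 : currentPairSum G Λ θ X ({some a} ∆ {some c}) (fun _ => 0) = 0 := by
    unfold currentPairSum; simp
  rw [← h0]
  refine currentPairSum_congr fun n₁ n₂ _ h2 => ?_
  by_cases hS : 𝒮[n₁ + n₂, b] = T
  · exfalso
    have hac : a ≠ c := fun h => hcT (h ▸ haT)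
    have hconn : Conn[n₁ + n₂, some a, some c] :=
      (cconn_of_csources_eq (fun h => hac (Option.some_injective _ h)) h2).mono fun e => Nat.le_add_left _ _
    have haS : (some a : Option V) ∈ 𝒮[n₁ + n₂, b] := hS ▸ haT
    have hcS : (some c : Option V) ∉ 𝒮[n₁ + n₂, b] := hS ▸ hcT
    rw [mem_clusterCompl] at haS hcS
    exact hcS ⟨Finset.some_mem_insertNone.2 hc, fun h => haS.2 (h.trans hconn.symm)⟩
  · rw [ind_of_false hS, zero_mul]

/-! ### Currents inside `T` have their sources inside `T` -/

/-- A current supported on the edges inside `T` has no source outside `T`: if `v ∈ A`, `v ∉ T`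
then `Z_T(A) = 0`. [folklore] -/
theorem gcurrentZ_inner_eq_zero_of_not_mem (θ : Sym2 (Option V) → ℝ) {T : Finset (Option V)} {A : Finset (Option V)}
    {v : Option V} (hvA : v ∈ A) (hvT : v ∉ T) : gcurrentZ Gg Λg θ (edgesIn Gg T) A = 0 := by
  unfold gcurrentZ
  refine ENNReal.tsum_eq_zero.2 fun n => ?_
  by_cases h : ∂g n = A ∧ CSupp Gg Λg (edgesIn Gg T) n
  · exfalso
    obtain ⟨hsrc, hsupp⟩ := h
    have hdeg : cdeg Gg Λg n v = 0 := by
      unfold cdeg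
      refine sum_eq_zero fun e _ => ?_
      by_cases hve : v ∈ (e : Sym2 (Option V))
      · rw [if_pos hve]
        by_contra hne
        exact hvT ((mem_edgesIn_iff.1 (hsupp e hne)).2 v hve)
      · rw [if_neg hve]
    have hv : v ∈ ∂g n := hsrc ▸ hvA
    rw [csources, mem_filter, hdeg] at hv
    exact Nat.not_odd_zero hv.2
  · rw [ind_of_false h, zero_mul]

/-- Hence `⟨σ_aσ_c⟩_{θ_T} = 0` if `a` or `c` is not in `T` (and `a ≠ c`). [folklore] -/
theorem thetaCorr_cplOff_pair_eq_zero {θ : Sym2 (Option V) → ℝ} (hθ : ∀ e, 0 ≤ θ e) {T : Finset (Option V)}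
    (hT : T ⊆ Λg) {a c : V} (ha : a ∈ Λ) (hc : c ∈ Λ) (hac : a ≠ c)
    (hout : (some a : Option V) ∉ T ∨ (some c : Option V) ∉ T) :
    thetaCorr G Λ (cplOff θ (Eg \ edgesIn Gg T)) ({a} ∆ {c}) = 0 := by
  rw [thetaCorr_cplOff_pair_eq hθ hT ha hc]
  have hac' : (some a : Option V) ≠ some c := fun h => hac (Option.some_injective _ h)
  rcases hout with haT | hcT
  · rw [gcurrentZ_inner_eq_zero_of_not_mem θ (A := {some a} ∆ {some c})
      (by rw [mem_symmDiff]; exact Or.inl ⟨mem_singleton_self _, fun h => hac' (mem_singleton.1 h)⟩) haT]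
    simp
  · rw [gcurrentZ_inner_eq_zero_of_not_mem θ (A := {some a} ∆ {some c})
      (by rw [mem_symmDiff]; exact Or.inr ⟨mem_singleton_self _, fun h => hac' (mem_singleton.1 h).symm⟩) hcT]
    simp

/-! ### The per-`T` identities behind (5.14) -/

/-- `W_b(T) = 0` if `b ∈ T`. [folklore] -/
theorem dctWb_eq_zero_of_mem (θ : Sym2 (Option V) → ℝ) {b : Option V} {T : Finset (Option V)} (hbT : b ∈ T) :
    dctWb G Λ θ b T = 0 := by
  unfold dctWb
  have h0 : currentPairSum G Λ θ ∅ ∅ (fun _ => 0) = 0 := by unfold currentPairSum; simp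
  rw [← h0]
  exact currentPairSum_congr fun n₁ n₂ _ _ =>
    ind_of_false fun h : 𝒮[n₁ + n₂, b] = T => not_mem_clusterCompl_self (n₁ + n₂) b (by rw [h]; exact hbT)

/-- A pair sum weighted by `𝟙[𝒮_b = T]` vanishes if `b ∈ T`. [folklore] -/
theorem currentPairSum_clusterCompl_eq_zero_of_mem (θ : Sym2 (Option V) → ℝ) {b : Option V} {T : Finset (Option V)}
    (hbT : b ∈ T) (X Y : Finset (Option V)) (F : (Eg → ℕ) → ℝ≥0∞) :
    currentPairSum G Λ θ X Y (fun m => ind (𝒮[m, b] = T) * F m) = 0 := by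
  have h0 : currentPairSum G Λ θ X Y (fun _ => 0) = 0 := by unfold currentPairSum; simp
  rw [← h0]
  exact currentPairSum_congr fun n₁ n₂ _ _ => by
    rw [ind_of_false (fun h : 𝒮[n₁ + n₂, b] = T => not_mem_clusterCompl_self (n₁ + n₂) b (by rw [h]; exact hbT)),
      zero_mul]

/-- **(5.1) with the event `x ↮ l`, for every `T`**: for `x, u, c', l ∈ Λ` and `T ⊆ Λ⁺`,
`∑_{({x}Δ{u})*, ({u}Δ{c'})*} w w 𝟙[𝒮_l = T] 𝟙[x ↮ l] = 𝟙[x* ∈ T] ⟨σ_xσ_u⟩_{θ_T} ⟨σ_uσ_{c'}⟩_{θ_T} W_l(T)`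
(the second pair shares the vertex `u` with the first, or is trivial, `c' = u`); all the
degenerate cases vanish on both sides. [cite: AizenmanFernandezJSP1986, §5.1, Lemma 5.1, eq. (5.1), p. 425] -/
theorem toReal_currentPairSum_clusterCompl_notConn_eq {θ : Sym2 (Option V) → ℝ} (hθ : ∀ e, 0 ≤ θ e)
    {T : Finset (Option V)} (hT : T ⊆ Λg) {x u c' l : V} (hx : x ∈ Λ) (hu : u ∈ Λ) (hc' : c' ∈ Λ) (hl : l ∈ Λ) :
    (currentPairSum G Λ θ ({some x} ∆ {some u}) ({some u} ∆ {some c'})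
        (fun m => ind (𝒮[m, some l] = T) * ind (¬Conn[m, some x, some l]))).toReal =
      (if (some x : Option V) ∈ T then 1 else 0) *
        (thetaCorr G Λ (cplOff θ (Eg \ edgesIn Gg T)) ({x} ∆ {u}) *
          thetaCorr G Λ (cplOff θ (Eg \ edgesIn Gg T)) ({u} ∆ {c'}) * (dctWb G Λ θ (some l) T).toReal) := by
  by_cases hlT : (some l : Option V) ∈ T
  · rw [currentPairSum_clusterCompl_eq_zero_of_mem θ hlT, dctWb_eq_zero_of_mem θ hlT]; simp
  have hb : (some l : Option V) ∈ Λg \ T := mem_sdiff.2 ⟨Finset.some_mem_insertNone.2 hl, hlT⟩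
  by_cases hxT : (some x : Option V) ∈ T
  swap
  · -- `x ∉ T`: the event `𝒮_l = T ∧ x ↮ l` is empty
    rw [if_neg hxT, zero_mul, ENNReal.toReal_eq_zero_iff]
    left
    have h0 : currentPairSum G Λ θ ({some x} ∆ {some u}) ({some u} ∆ {some c'}) (fun _ => 0) = 0 := by
      unfold currentPairSum; simp
    rw [← h0]
    refine currentPairSum_congr fun n₁ n₂ _ _ => ?_
    by_cases hS : 𝒮[n₁ + n₂, some l] = T
    · rw [ind_of_true hS, one_mul]
      refine ind_of_false (not_not.2 ?_)
      by_contra hnc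
      exact hxT (hS ▸ mem_clusterCompl.2 ⟨Finset.some_mem_insertNone.2 hx, fun h => hnc h.symm⟩)
    · rw [ind_of_false hS, zero_mul]
  rw [if_pos hxT, one_mul]
  by_cases huT : (some u : Option V) ∈ T
  swap
  · have hxu : x ≠ u := fun h => huT (h ▸ hxT)
    rw [currentPairSum_clusterCompl_eq_zero_left θ hxT huT hu,
      thetaCorr_cplOff_pair_eq_zero hθ hT hx hu hxu (Or.inr huT)]
    simp
  -- `x, u ∈ T`: the extra indicator is `1`
  have hdrop : currentPairSum G Λ θ ({some x} ∆ {some u}) ({some u} ∆ {some c'})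
      (fun m => ind (𝒮[m, some l] = T) * ind (¬Conn[m, some x, some l])) =
      currentPairSum G Λ θ ({some x} ∆ {some u}) ({some u} ∆ {some c'}) (fun m => ind (𝒮[m, some l] = T)) := by
    refine currentPairSum_congr fun n₁ n₂ _ _ => ?_
    by_cases hS : 𝒮[n₁ + n₂, some l] = T
    · have hxS : (some x : Option V) ∈ 𝒮[n₁ + n₂, some l] := hS ▸ hxT
      rw [ind_of_true hS, ind_of_true (fun h => (mem_clusterCompl.1 hxS).2 h.symm), mul_one]
    · rw [ind_of_false hS, zero_mul]
  rw [hdrop]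
  by_cases huc : u = c'
  · -- trivial second pair
    subst huc
    have hY : ({some u} ∆ {some u} : Finset (Option V)) = ∅ := symmDiff_self _
    have hY' : ({u} ∆ {u} : Finset V) = ∅ := symmDiff_self _
    rw [hY, hY', thetaCorr_empty, mul_one]
    have hX : ({some x} ∆ {some u} : Finset (Option V)) ⊆ T :=
      symmDiff_le_sup.trans (sup_le (singleton_subset_iff.2 hxT) (singleton_subset_iff.2 huT))
    have h1 := congrArg ENNReal.toReal (currentPairSum_clusterCompl_mul_eq (G := G) (Λ := Λ) (θ := θ) hT hb hX (empty_subset T))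
    rw [ENNReal.toReal_mul, ENNReal.toReal_mul, ENNReal.toReal_mul, ENNReal.toReal_mul] at h1
    have hpos := toReal_gcurrentZ_inner_empty_pos (G := G) (Λ := Λ) hθ hT
    rw [thetaCorr_cplOff_pair_eq hθ hT hx hu, div_mul_eq_mul_div, eq_div_iff hpos.ne']
    have h2 : (currentPairSum G Λ θ ({some x} ∆ {some u}) ∅ (fun m => ind (𝒮[m, some l] = T))).toReal *
        (gcurrentZ Gg Λg θ (edgesIn Gg T) ∅).toReal * (gcurrentZ Gg Λg θ (edgesIn Gg T) ∅).toReal =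
        (gcurrentZ Gg Λg θ (edgesIn Gg T) ({some x} ∆ {some u})).toReal * (dctWb G Λ θ (some l) T).toReal *
          (gcurrentZ Gg Λg θ (edgesIn Gg T) ∅).toReal := by
      rw [mul_assoc, h1]; ring
    exact mul_right_cancel₀ hpos.ne' h2
  by_cases hcT : (some c' : Option V) ∈ T
  swap
  · rw [show (fun m => ind (𝒮[m, some l] = T)) = (fun m : Eg → ℕ => ind (𝒮[m, some l] = T) * 1) from
        funext fun _ => (mul_one _).symm,
      currentPairSum_clusterCompl_eq_zero_right θ huT hcT hc',
      thetaCorr_cplOff_pair_eq_zero hθ hT hu hc' huc (Or.inr hcT)]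
    simp
  exact toReal_currentPairSum_pairs_clusterCompl_eq hθ hT hb hx hu hu hc' hxT huT huT hcT

/-! ### Lemma 5.4 -/

/-- `({x}Δ{u}) Δ ({x}Δ{l}) = {u} Δ {l}` for lifted singletons. [folklore] -/
theorem pair_symmDiff_pair_left (p q r : Option V) :
    (({p} ∆ {q}) ∆ ({p} ∆ {r}) : Finset (Option V)) = {q} ∆ {r} := by
  ext v; simp only [mem_symmDiff, mem_singleton]; tauto

/-- **The switched first moment**: `∑_{({x}Δ{u})*, ∅} w w 𝟙[x ↔ l] = Z(({u}Δ{l})*) Z(({x}Δ{l})*)`. [cite: AizenmanFernandezJSP1986, §5.1, proof of Lemma 5.4 ("Along the way we used the Switching Lemma"), p. 429] -/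
theorem currentPairSum_pair_empty_conn_eq {θ : Sym2 (Option V) → ℝ} (hθ : ∀ e, 0 ≤ θ e) (x u l : V) :
    currentPairSum G Λ θ ({some x} ∆ {some u}) ∅ (fun m => ind (Conn[m, some x, some l])) =
      Zg[θ, {some u} ∆ {some l}] * Zg[θ, {some x} ∆ {some l}] := by
  have h := currentPairSum_switching (G := G) (Λ := Λ) hθ ({some x} ∆ {some u}) (some x) (some l) (fun _ => 1)
  rw [pair_symmDiff_pair_left] at h
  rw [← currentPairSum_one, h]
  exact (currentPairSum_congr fun _ _ _ _ => by rw [one_mul]).symm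

/-- **Aizenman–Fernández 1986, Lemma 5.4 (the tree bound), for general couplings `θ ≥ 0`**:
for `x, u, y, l ∈ Λ`,
`Z⁻² ∑_{∂n₁ = {x}Δ{u}, ∂n₂ = {u}Δ{y}} w_θ w_θ 𝟙[x ↔ l] ≤ ⟨σ_xσ_l⟩⟨σ_lσ_u⟩⟨σ_uσ_y⟩ + ⟨σ_yσ_l⟩⟨σ_lσ_u⟩⟨σ_uσ_x⟩`
(all `⟨·⟩ = ⟨·⟩_θ`; printed at `h = 0`, the proof — `𝟙[x↔l] = 1 - 𝟙[x↮l]`, conditioning on the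
cluster of `l` (5.1), (5.14), Griffiths II, switching — is coupling-independent). [cite: AizenmanFernandezJSP1986, §5.1, Lemma 5.4, eqs. (5.13)–(5.14), pp. 428–429] -/
theorem af_treeBound {θ : Sym2 (Option V) → ℝ} (hθ : ∀ e, 0 ≤ θ e) {x u y l : V} (hx : x ∈ Λ) (hu : u ∈ Λ)
    (hy : y ∈ Λ) (hl : l ∈ Λ) :
    (currentPairSum G Λ θ ({some x} ∆ {some u}) ({some u} ∆ {some y}) (fun m => ind (Conn[m, some x, some l]))).toReal /
        (Zg[θ, ∅]).toReal ^ 2 ≤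
      thetaCorr G Λ θ ({x} ∆ {l}) * thetaCorr G Λ θ ({l} ∆ {u}) * thetaCorr G Λ θ ({u} ∆ {y}) +
        thetaCorr G Λ θ ({y} ∆ {l}) * thetaCorr G Λ θ ({l} ∆ {u}) * thetaCorr G Λ θ ({u} ∆ {x}) := by
  classical
  -- notation
  set Z : ℝ := (Zg[θ, ∅]).toReal with hZ
  have hZpos : 0 < Z := toReal_gcurrentZ_ghost_empty_pos subset_rfl hθ subset_rfl
  have hZ2 : 0 < Z ^ 2 := pow_pos hZpos 2
  set P := (Λg).powerset with hP
  set Gf : V → V → ℝ := fun a c => thetaCorr G Λ θ ({a} ∆ {c}) with hGf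
  set GT : Finset (Option V) → V → V → ℝ := fun T a c => thetaCorr G Λ (cplOff θ (Eg \ edgesIn Gg T)) ({a} ∆ {c}) with hGT
  set w : Finset (Option V) → ℝ := fun T => (dctWb G Λ θ (some l) T).toReal / Z ^ 2 with hw
  have hw0 : ∀ T, 0 ≤ w T := fun T => div_nonneg ENNReal.toReal_nonneg hZ2.le
  have hGT0 : ∀ T a c, a ∈ Λ → c ∈ Λ → 0 ≤ GT T a c := fun T a c ha hc => thetaCorr_cplOff_pair_nonneg hθ T ha hc
  have hGTle : ∀ T a c, a ∈ Λ → c ∈ Λ → GT T a c ≤ Gf a c := fun T a c ha hc => thetaCorr_cplOff_pair_le hθ T ha hc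
  have hGf0 : ∀ a c, a ∈ Λ → c ∈ Λ → 0 ≤ Gf a c := fun a c ha hc =>
    thetaCorr_nonneg hθ (symmDiff_le_sup.trans (sup_le (singleton_subset_iff.2 ha) (singleton_subset_iff.2 hc)))
  have hGsymm : ∀ a c, Gf a c = Gf c a := fun a c => by simp only [hGf, symmDiff_comm]
  -- two-point functions as current sums
  have hpair : ∀ {a c : V}, a ∈ Λ → c ∈ Λ → (Zg[θ, {some a} ∆ {some c}]).toReal = Gf a c * Z := by
    intro a c ha hc
    have := thetaCorr_eq_gcurrentZ_div (G := G) (Λ := Λ) hθ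
      (symmDiff_le_sup.trans (sup_le (singleton_subset_iff.2 ha) (singleton_subset_iff.2 hc)) : ({a} ∆ {c} : Finset V) ⊆ Λ)
    rw [starSet_pair] at this
    simp only [hGf]
    rw [this, div_mul_cancel₀ _ hZpos.ne']
  -- sources
  set X : Finset (Option V) := {some x} ∆ {some u} with hXdef
  set Y : Finset (Option V) := {some u} ∆ {some y} with hYdef
  -- per-`T` data
  set W : Finset (Option V) → ℝ := fun T => (dctWb G Λ θ (some l) T).toReal with hW
  have hW0 : ∀ T, 0 ≤ W T := fun T => ENNReal.toReal_nonneg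
  have hmass : ∑ T ∈ P, W T = Z ^ 2 := by
    simp only [hW]
    rw [← ENNReal.toReal_sum (fun T _ => dctWb_ne_top hθ _ _), sum_dctWb_eq, ENNReal.toReal_mul, ← hZ, sq]
  set a : Finset (Option V) → ℝ := fun T => if (some x : Option V) ∈ T then 1 else 0 with ha
  set c : Finset (Option V) → ℝ := fun T => if (some u : Option V) ∈ T then 1 else 0 with hc
  have ha01 : ∀ T, 0 ≤ a T ∧ a T ≤ 1 := fun T => by simp only [ha]; split_ifs <;> norm_num
  have hc01 : ∀ T, 0 ≤ c T ∧ c T ≤ 1 := fun T => by simp only [hc]; split_ifs <;> norm_num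
  -- (A) `𝟙[x↔l] = 1 - 𝟙[x↮l]`
  have hsplit : ∀ (X' Y' : Finset (Option V)) (p q : Option V),
      (currentPairSum G Λ θ X' Y' (fun m => ind (Conn[m, p, q]))).toReal =
        (Zg[θ, X']).toReal * (Zg[θ, Y']).toReal -
          (currentPairSum G Λ θ X' Y' (fun m => ind (¬Conn[m, p, q]))).toReal := by
    intro X' Y' p q
    have h1 : currentPairSum G Λ θ X' Y' (fun m => ind (Conn[m, p, q])) +
        currentPairSum G Λ θ X' Y' (fun m => ind (¬Conn[m, p, q])) = Zg[θ, X'] * Zg[θ, Y'] := by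
      rw [← currentPairSum_add, ← currentPairSum_one]
      refine currentPairSum_congr fun n₁ n₂ _ _ => ?_
      by_cases h : Conn[n₁ + n₂, p, q]
      · rw [ind_of_true h, ind_of_false (not_not.2 h), add_zero]
      · rw [ind_of_false h, ind_of_true h, zero_add]
    have h2 := congrArg ENNReal.toReal h1
    rw [ENNReal.toReal_add (currentPairSum_ne_top hθ _ _ fun _ => ind_le_one _)
      (currentPairSum_ne_top hθ _ _ fun _ => ind_le_one _), ENNReal.toReal_mul] at h2
    linarith
  -- (B) conditioning of the `x ↮ l` terms on `𝒮_l`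
  have hcond : ∀ (c' : V) (_ : c' ∈ Λ) (x' u' : V) (_ : x' ∈ Λ) (_ : u' ∈ Λ),
      (currentPairSum G Λ θ ({some x'} ∆ {some u'}) ({some u'} ∆ {some c'})
          (fun m => ind (¬Conn[m, some x', some l]))).toReal =
        ∑ T ∈ P, (if (some x' : Option V) ∈ T then 1 else 0) * (GT T x' u' * GT T u' c' * W T) := by
    intro c' hc' x' u' hx' hu'
    rw [currentPairSum_eq_sum_clusterCompl' θ (some l), ENNReal.toReal_sum (fun T _ =>
      currentPairSum_ne_top hθ _ _ fun m => by
        refine le_trans (mul_le_mul' (ind_le_one _) (ind_le_one _)) ?_; rw [one_mul])]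
    refine sum_congr rfl fun T hTP => ?_
    exact toReal_currentPairSum_clusterCompl_notConn_eq hθ (mem_powerset.1 hTP) hx' hu' hc' hl
  -- the three instances
  have hNXY := hcond y hy x u hx hu
  have hNX : (currentPairSum G Λ θ X ∅ (fun m => ind (¬Conn[m, some x, some l]))).toReal =
      ∑ T ∈ P, a T * (GT T x u * W T) := by
    have h := hcond u hu x u hx hu
    have hY0 : ({some u} ∆ {some u} : Finset (Option V)) = ∅ := symmDiff_self _
    rw [hY0] at h
    rw [h]
    refine sum_congr rfl fun T _ => ?_
    have : GT T u u = 1 := by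
      simp only [hGT]
      rw [show ({u} ∆ {u} : Finset V) = ∅ from symmDiff_self _, thetaCorr_empty]
    rw [this, mul_one]
  have hNY : (currentPairSum G Λ θ Y ∅ (fun m => ind (¬Conn[m, some u, some l]))).toReal =
      ∑ T ∈ P, c T * (GT T u y * W T) := by
    have h := hcond y hy u y hu hy
    have hY0 : ({some y} ∆ {some y} : Finset (Option V)) = ∅ := symmDiff_self _
    rw [hY0] at h
    rw [h]
    refine sum_congr rfl fun T _ => ?_
    have : GT T y y = 1 := by
      simp only [hGT]
      rw [show ({y} ∆ {y} : Finset V) = ∅ from symmDiff_self _, thetaCorr_empty]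
    rw [this, mul_one]
  -- (C) the switched first moments
  have hCX : (currentPairSum G Λ θ X ∅ (fun m => ind (¬Conn[m, some x, some l]))).toReal =
      Gf x u * Z * Z - Gf u l * Z * (Gf x l * Z) := by
    have h := hsplit X ∅ (some x) (some l)
    rw [currentPairSum_pair_empty_conn_eq hθ, ENNReal.toReal_mul, hpair hu hl, hpair hx hl, hpair hx hu, ← hZ] at h
    linarith
  have hCY : (currentPairSum G Λ θ Y ∅ (fun m => ind (¬Conn[m, some u, some l]))).toReal =
      Gf u y * Z * Z - Gf y l * Z * (Gf u l * Z) := by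
    have h := hsplit Y ∅ (some u) (some l)
    rw [currentPairSum_pair_empty_conn_eq hθ, ENNReal.toReal_mul, hpair hy hl, hpair hu hl, hpair hu hy, ← hZ] at h
    linarith
  -- (D) the main estimate
  have hmain : (currentPairSum G Λ θ X Y (fun m => ind (Conn[m, some x, some l]))).toReal ≤
      (Gf u y * (Gf u l * Gf x l) + Gf x u * (Gf y l * Gf u l)) * Z ^ 2 := by
    rw [hsplit X Y (some x) (some l), hpair hx hu, hpair hu hy, hNXY]
    -- termwise: `a g_X g_Y ≥ a (g_X G_Y + G_X g_Y - G_X G_Y)`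
    have hterm : ∀ T ∈ P, a T * (GT T x u * Gf u y + Gf x u * GT T u y - Gf x u * Gf u y) * W T ≤
        (if (some x : Option V) ∈ T then 1 else 0) * (GT T x u * GT T u y * W T) := by
      intro T _
      show a T * (GT T x u * Gf u y + Gf x u * GT T u y - Gf x u * Gf u y) * W T ≤ a T * (GT T x u * GT T u y * W T)
      have hprod : 0 ≤ (Gf x u - GT T x u) * (Gf u y - GT T u y) :=
        mul_nonneg (sub_nonneg.2 (hGTle T x u hx hu)) (sub_nonneg.2 (hGTle T u y hu hy))
      have : a T * (GT T x u * Gf u y + Gf x u * GT T u y - Gf x u * Gf u y) * W T ≤ a T * (GT T x u * GT T u y) * W T :=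
        mul_le_mul_of_nonneg_right (mul_le_mul_of_nonneg_left (by nlinarith) (ha01 T).1) (hW0 T)
      linarith [this]
    have hsum1 : ∑ T ∈ P, a T * (GT T x u * Gf u y + Gf x u * GT T u y - Gf x u * Gf u y) * W T ≤
        ∑ T ∈ P, (if (some x : Option V) ∈ T then 1 else 0) * (GT T x u * GT T u y * W T) := sum_le_sum hterm
    -- expand the lower sum
    have hexp : ∑ T ∈ P, a T * (GT T x u * Gf u y + Gf x u * GT T u y - Gf x u * Gf u y) * W T =
        Gf u y * ∑ T ∈ P, a T * (GT T x u * W T) + Gf x u * ∑ T ∈ P, a T * ((GT T u y - Gf u y) * W T) := by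
      rw [mul_sum, mul_sum, ← sum_add_distrib]
      exact sum_congr rfl fun T _ => by ring
    -- the second sum: drop `a ≤ 1`, then restore `c ≤ 1`
    have hsum2 : ∑ T ∈ P, a T * ((GT T u y - Gf u y) * W T) ≥ ∑ T ∈ P, (GT T u y - Gf u y) * W T := by
      refine sum_le_sum fun T _ => ?_
      have hneg : (GT T u y - Gf u y) * W T ≤ 0 :=
        mul_nonpos_of_nonpos_of_nonneg (sub_nonpos.2 (hGTle T u y hu hy)) (hW0 T)
      nlinarith [(ha01 T).1, (ha01 T).2]
    have hsum3 : ∑ T ∈ P, (GT T u y - Gf u y) * W T ≥ ∑ T ∈ P, c T * (GT T u y * W T) - Gf u y * Z ^ 2 := by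
      rw [← hmass, mul_sum, ← sum_sub_distrib]
      refine sum_le_sum fun T _ => ?_
      have h0 : 0 ≤ GT T u y * W T := mul_nonneg (hGT0 T u y hu hy) (hW0 T)
      nlinarith [(hc01 T).1, (hc01 T).2]
    rw [← hNX, hCX] at hexp
    rw [← hNY, hCY] at hsum3
    nlinarith [hGf0 x u hx hu, hGf0 u y hu hy, hsum1, hsum2, hsum3, hexp]
  -- conclude
  rw [div_le_iff₀ hZ2]
  calc (currentPairSum G Λ θ X Y (fun m => ind (Conn[m, some x, some l]))).toReal
      ≤ (Gf u y * (Gf u l * Gf x l) + Gf x u * (Gf y l * Gf u l)) * Z ^ 2 := hmain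
    _ = _ := by
        simp only [hGf]
        rw [show ({l} ∆ {u} : Finset V) = {u} ∆ {l} from symmDiff_comm _ _,
          show ({u} ∆ {x} : Finset V) = {x} ∆ {u} from symmDiff_comm _ _]
        ring

/-! ### Factorisation on `{𝒮_b = S}` with an inner functional -/

/-- **Factorisation of a pair sum on `{𝒮_b(n₁+n₂) = S}` with a functional of the inner currents**
(the step "decompose `R` into a sum over clusters `C^c_{n₁+n₂}(h)`" of Aizenman–Fernández 1986,
p. 439): for `S ⊆ Λ ∪ {g}`, `b ∉ S` and `F` depending only on the currents inside `S`,
`∑_{X,Y} w w 𝟙[𝒮_b = S] F = (∑^{θ_S}_{X∩S, Y∩S} w w F) · Ψ_S(X∖S, Y∖S)`, where `θ_S = θ 𝟙_{ℰ_S}` is the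
system restricted to `S` (`currentPairSum_cplOff`) and `Ψ_S` the outer sum of
`currentPairSum_clusterCompl_eq`. [cite: AizenmanFernandezJSP1986, §5.2, proof of Thm. 5.7, p. 439 ("decompose R into a sum over clusters")] [cite: DuminilCopinTassionCMP2016, proof of Lemma 2.6, Claims 1–2 (arXiv:1502.03050 numbering)] -/
theorem currentPairSum_clusterCompl_inner_eq (θ : Sym2 (Option V) → ℝ) {S : Finset (Option V)} (hS : S ⊆ Λg)
    {b : Option V} (hb : b ∈ Λg \ S) (X Y : Finset (Option V)) {F : (Eg → ℕ) → ℝ≥0∞}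
    (hF : ∀ m, F m = F (crestr Gg Λg (edgesIn Gg S) m)) :
    currentPairSum G Λ θ X Y (fun m => ind (𝒮[m, b] = S) * F m) =
      currentPairSum G Λ (cplOff θ (Eg \ edgesIn Gg S)) (X.filter (· ∈ S)) (Y.filter (· ∈ S)) F *
        outerSum G Λ θ S b (X.filter (· ∉ S)) (Y.filter (· ∉ S)) := by
  set E₁ := edgesIn Gg S with hE₁
  set E₂ := edgesIn Gg (Λg \ S) with hE₂
  have hdisj : Disjoint E₁ E₂ := disjoint_edgesIn_sdiff S
  set G₁ : (Eg → ℕ) → (Eg → ℕ) → ℝ≥0∞ := fun a₁ a₂ =>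
    ind (∂g a₁ = X.filter (· ∈ S)) * ind (∂g a₂ = Y.filter (· ∈ S)) *
      (gweight Gg Λg θ a₁ * gweight Gg Λg θ a₂ * F (a₁ + a₂)) with hG₁
  set G₂ : (Eg → ℕ) → (Eg → ℕ) → ℝ≥0∞ := fun b₁ b₂ =>
    ind (∂g b₁ = X.filter (· ∉ S)) * ind (∂g b₂ = Y.filter (· ∉ S)) *
      (gweight Gg Λg θ b₁ * gweight Gg Λg θ b₂ * ind (∀ v ∈ Λg \ S, CConn Gg Λg (b₁ + b₂) E₂ b v))
    with hG₂
  have hpt : ∀ p : (Eg → ℕ) × (Eg → ℕ),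
      ind (∂g p.1 = X ∧ CSupp Gg Λg Eg p.1) * ind (∂g p.2 = Y ∧ CSupp Gg Λg Eg p.2) *
          (gweight Gg Λg θ p.1 * gweight Gg Λg θ p.2 * (ind (𝒮[p.1 + p.2, b] = S) * F (p.1 + p.2))) =
        ind (CSupp Gg Λg (E₁ ∪ E₂) p.1) * ind (CSupp Gg Λg (E₁ ∪ E₂) p.2) *
          (G₁ (crestr Gg Λg E₁ p.1) (crestr Gg Λg E₁ p.2) * G₂ (crestr Gg Λg E₂ p.1) (crestr Gg Λg E₂ p.2)) := by
    intro p
    by_cases hcut : CSupp Gg Λg (E₁ ∪ E₂) p.1 ∧ CSupp Gg Λg (E₁ ∪ E₂) p.2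
    · obtain ⟨hc1, hc2⟩ := hcut
      have hc12 : CSupp Gg Λg (E₁ ∪ E₂) (p.1 + p.2) := (csupp_add_iff p.1 p.2).2 ⟨hc1, hc2⟩
      rw [ind_of_true hc1, ind_of_true hc2, one_mul, one_mul]
      have hsrc : ∀ (n : Eg → ℕ) (Z : Finset (Option V)), CSupp Gg Λg (E₁ ∪ E₂) n →
          (ind (∂g n = Z ∧ CSupp Gg Λg Eg n) =
            ind (∂g (crestr Gg Λg E₁ n) = Z.filter (· ∈ S)) * ind (∂g (crestr Gg Λg E₂ n) = Z.filter (· ∉ S))) := by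
        intro n Z hn
        rw [← ind_and]
        refine ind_congr ?_
        rw [csources_crestr_inner hn, csources_crestr_outer hn]
        constructor
        · rintro ⟨h, -⟩
          rw [h]
          exact ⟨rfl, rfl⟩
        · rintro ⟨h1, h2⟩
          refine ⟨?_, csupp_edgesIn n⟩
          rw [← filter_union_filter_not_eq (· ∈ S) (∂g n), ← filter_union_filter_not_eq (· ∈ S) Z, h1, h2]
      have hw1 := gweight_eq_mul_of_csupp_union θ hdisj hc1
      have hw2 := gweight_eq_mul_of_csupp_union θ hdisj hc2
      have hev : ind (𝒮[p.1 + p.2, b] = S) =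
          ind (∀ v ∈ Λg \ S, CConn Gg Λg (crestr Gg Λg E₂ p.1 + crestr Gg Λg E₂ p.2) E₂ b v) := by
        refine ind_congr ?_
        rw [clusterCompl_eq_iff hS hb, ← crestr_add]
        simp only [cconn_crestr_iff]
        exact ⟨fun h => h.2, fun h => ⟨hc12, h⟩⟩
      have hFin : F (p.1 + p.2) = F (crestr Gg Λg E₁ p.1 + crestr Gg Λg E₁ p.2) := by
        rw [hF, crestr_add]
      rw [hsrc p.1 X hc1, hsrc p.2 Y hc2, hw1, hw2, hev, hFin]
      simp only [hG₁, hG₂]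
      ring
    · have hzero : ind (𝒮[p.1 + p.2, b] = S) = 0 ∨
          (CSupp Gg Λg (E₁ ∪ E₂) p.1 ∧ CSupp Gg Λg (E₁ ∪ E₂) p.2) := by
        by_cases hS' : 𝒮[p.1 + p.2, b] = S
        · exact Or.inr ((csupp_add_iff p.1 p.2).1 (csupp_cut_of_clusterCompl_eq hS'))
        · exact Or.inl (ind_of_false hS')
      rcases hzero with h0 | h
      · rw [h0, zero_mul, mul_zero, mul_zero]
        rcases not_and_or.1 hcut with h1 | h2
        · rw [ind_of_false h1, zero_mul, zero_mul]
        · rw [ind_of_false h2, mul_zero, zero_mul]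
      · exact absurd h hcut
  -- the inner sum is the pair sum of the restricted system
  have hinner : ∑' q : (Eg → ℕ) × (Eg → ℕ), ind (CSupp Gg Λg E₁ q.1 ∧ CSupp Gg Λg E₁ q.2) * G₁ q.1 q.2 =
      currentPairSum G Λ (cplOff θ (Eg \ E₁)) (X.filter (· ∈ S)) (Y.filter (· ∈ S)) F := by
    rw [currentPairSum_cplOff]
    unfold currentPairSum
    refine tsum_congr fun q => ?_
    have hE : Eg \ (Eg \ E₁) = E₁ := Finset.sdiff_sdiff_eq_self (edgesIn_mono Gg hS)
    rw [hE]
    have hadd : ind (CSupp Gg Λg E₁ (q.1 + q.2)) = ind (CSupp Gg Λg E₁ q.1 ∧ CSupp Gg Λg E₁ q.2) :=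
      ind_congr (csupp_add_iff q.1 q.2)
    dsimp only
    have e1 : ind (∂g q.1 = X.filter (· ∈ S) ∧ CSupp Gg Λg Eg q.1) = ind (∂g q.1 = X.filter (· ∈ S)) :=
      ind_congr ⟨fun h => h.1, fun h => ⟨h, csupp_edgesIn _⟩⟩
    have e2 : ind (∂g q.2 = Y.filter (· ∈ S) ∧ CSupp Gg Λg Eg q.2) = ind (∂g q.2 = Y.filter (· ∈ S)) :=
      ind_congr ⟨fun h => h.1, fun h => ⟨h, csupp_edgesIn _⟩⟩
    rw [hadd, e1, e2]
    by_cases hq : CSupp Gg Λg E₁ q.1 ∧ CSupp Gg Λg E₁ q.2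
    · rw [ind_of_true hq, one_mul]
      simp only [hG₁]
      ring
    · rw [ind_of_false hq, zero_mul]
      ring
  unfold currentPairSum
  simp_rw [hpt]
  rw [tsum_pair_eq_mul_of_csupp_union Gg Λg hdisj G₁ G₂, hinner]
  rfl

/-- **The case of inner sources**: for `X, Y ⊆ S`,
`∑_{X,Y} w w 𝟙[𝒮_b = S] F · Z_S(∅)² = (∑^{θ_S}_{X,Y} w w F) · W_b(S)`. [cite: AizenmanFernandezJSP1986, §5.2, proof of Thm. 5.7, p. 439] -/
theorem currentPairSum_clusterCompl_inner_mul_eq (θ : Sym2 (Option V) → ℝ) {S : Finset (Option V)} (hS : S ⊆ Λg)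
    {b : Option V} (hb : b ∈ Λg \ S) {X Y : Finset (Option V)} (hX : X ⊆ S) (hY : Y ⊆ S)
    {F : (Eg → ℕ) → ℝ≥0∞} (hF : ∀ m, F m = F (crestr Gg Λg (edgesIn Gg S) m)) :
    currentPairSum G Λ θ X Y (fun m => ind (𝒮[m, b] = S) * F m) *
        (gcurrentZ Gg Λg θ (edgesIn Gg S) ∅ * gcurrentZ Gg Λg θ (edgesIn Gg S) ∅) =
      currentPairSum G Λ (cplOff θ (Eg \ edgesIn Gg S)) X Y F * dctWb G Λ θ b S := by
  unfold dctWb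
  rw [currentPairSum_clusterCompl_inner_eq θ hS hb X Y hF, currentPairSum_clusterCompl_eq θ hS hb,
    filter_true_of_mem (fun v hv => hX hv), filter_false_of_mem (fun v hv => not_not.2 (hX hv)),
    filter_true_of_mem (fun v hv => hY hv), filter_false_of_mem (fun v hv => not_not.2 (hY hv))]
  simp only [filter_empty]
  ring

end TreeBound

end Literature.Probability.LatticeModels
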